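import Mathlib
import Summits.Ventures.PercRepro2.Defs
import Summits.Ventures.PercRepro2.Harris
import Summits.Ventures.PercRepro2.CoinDefs
import Summits.Ventures.PercRepro2.CoinReverse
import Summits.Ventures.PercRepro2.CoinLsmCoreDefs
import Summits.Ventures.PercRepro2.CoinLsmCoreU
import Summits.Ventures.PercRepro2.CoinSquareCoreDefs
import Summits.Ventures.PercRepro2.CoinD21Alg
import Summits.Ventures.PercRepro2.CoinOrTailAlg
import Summits.Ventures.PercRepro2.CoinOrTailDefs
import Summits.Ventures.PercRepro2.CoinOrTail3Cells
import Summits.Ventures.PercRepro2.CoinOrTailLsmDefs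
import Summits.Ventures.PercRepro2.CoinOrTailLsmSums

/-!
# The UNDIRECTED TRIANGLE with a tail, I: the structure and its reachability (blind cell
PercRepro2, night-2 g9; proofs/NIGHT2-DARC.md §37)

`TriCore arcs s p q a c₁ c₂ c₃ cρ cτ`: the three antiparallel-pair coins `c₁ = s ↔ p`,
`c₂ = s ↔ q`, `c₃ = p ↔ q` (the undirected triangle) and the two single-arc tail coins
`cρ = p → a`, `cτ = q → a` are the only coins with an arc into `{s, p, q, a}`.  The core
`U = {p, q}` (pairs at the root: `OrTailU.into_s`) has the cluster law `ν(∅) = (1−α)(1−β)`,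
`ν({p}) = α(1−β)(1−γ)`, `ν({q}) = (1−α)β(1−γ)`, `ν({p, q}) = αβ + α(1−β)γ + (1−α)βγ`, which is
log-supermodular (the one non-trivial pair has the slack
`α(1−α)β(1−β)γ(2−γ) + (1−α)(1−β)γ(α(1−β) + (1−α)β)`), so `darc_of_orTailLsm` applies:
**row 2′DARC holds at `a → w` for the markers `p, q` and every head** (`darc_of_triCore`) — the
undirected triangle base of the row's OR-tail with directed tail arcs.

This file: the structure `TriCore`, `TriCore.orTailU`, and the reachability of `p`, `q` on the
triangle (`reach_p_iff`, `reach_q_iff`).  The cluster law and the theorem are in `CoinTriCore`.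
-/

namespace Summit.Ventures.PercRepro2.Coin

open Classical

section TriCoreDefs

variable {V : Type*} {E : Type*} [DecidableEq V]

/-- The undirected triangle with a tail: `s ↔ p`, `s ↔ q`, `p ↔ q`, `p → a`, `q → a`, and «no
other coin enters `{s, p, q, a}`». -/
structure TriCore (arcs : E → Finset (V × V)) (s p q a : V) (c₁ c₂ c₃ cρ cτ : E) : Prop where
  arc₁ : arcs c₁ = {(s, p), (p, s)}
  arc₂ : arcs c₂ = {(s, q), (q, s)}
  arc₃ : arcs c₃ = {(p, q), (q, p)}
  arcρ : arcs cρ = {(p, a)}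
  arcτ : arcs cτ = {(q, a)}
  core : ∀ e, ∀ xy ∈ arcs e, (xy.2 = s ∨ xy.2 = p ∨ xy.2 = q ∨ xy.2 = a) →
    e = c₁ ∨ e = c₂ ∨ e = c₃ ∨ e = cρ ∨ e = cτ
  sp : s ≠ p
  sq : s ≠ q
  sa : s ≠ a
  pq : p ≠ q
  pa : p ≠ a
  qa : q ≠ a
  ρτ : cρ ≠ cτ

variable {arcs : E → Finset (V × V)} {s p q a : V} {c₁ c₂ c₃ cρ cτ : E}

/-- The triangle core is an OR-tail on the core `U = {p, q}` (pairs at the root allowed). -/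
theorem TriCore.orTailU (h : TriCore arcs s p q a c₁ c₂ c₃ cρ cτ) :
    OrTailU arcs s {p, q} p q a cρ cτ where
  p_mem := by simp
  q_mem := by simp
  s_notin := by simp [h.sp, h.sq]
  a_notin := by simp [h.pa.symm, h.qa.symm]
  a_ne_s := h.sa.symm
  into_U := by
    intro e xy hxy hy
    simp only [Finset.mem_insert, Finset.mem_singleton] at hy ⊢
    have hc := h.core e xy hxy (by tauto)
    rcases hc with rfl | rfl | rfl | rfl | rfl
    · rw [h.arc₁] at hxy
      simp only [Finset.mem_insert, Finset.mem_singleton] at hxy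
      rcases hxy with rfl | rfl <;> simp
    · rw [h.arc₂] at hxy
      simp only [Finset.mem_insert, Finset.mem_singleton] at hxy
      rcases hxy with rfl | rfl <;> simp
    · rw [h.arc₃] at hxy
      simp only [Finset.mem_insert, Finset.mem_singleton] at hxy
      rcases hxy with rfl | rfl <;> simp
    · rw [h.arcρ, Finset.mem_singleton] at hxy; subst hxy
      simp only at hy; rcases hy with hy | hy
      · exact absurd hy h.pa.symm
      · exact absurd hy h.qa.symm
    · rw [h.arcτ, Finset.mem_singleton] at hxy; subst hxy
      simp only at hy; rcases hy with hy | hy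
      · exact absurd hy h.pa.symm
      · exact absurd hy h.qa.symm
  into_s := by
    intro e xy hxy hy
    have hc := h.core e xy hxy (Or.inl hy)
    simp only [Finset.mem_insert, Finset.mem_singleton]
    rcases hc with rfl | rfl | rfl | rfl | rfl
    · rw [h.arc₁] at hxy
      simp only [Finset.mem_insert, Finset.mem_singleton] at hxy
      rcases hxy with rfl | rfl
      · exact absurd hy.symm h.sp
      · simp
    · rw [h.arc₂] at hxy
      simp only [Finset.mem_insert, Finset.mem_singleton] at hxy
      rcases hxy with rfl | rfl
      · exact absurd hy.symm h.sq
      · simp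
    · rw [h.arc₃] at hxy
      simp only [Finset.mem_insert, Finset.mem_singleton] at hxy
      rcases hxy with rfl | rfl
      · exact absurd hy.symm h.sq
      · exact absurd hy.symm h.sp
    · rw [h.arcρ, Finset.mem_singleton] at hxy; subst hxy; exact absurd hy.symm h.sa
    · rw [h.arcτ, Finset.mem_singleton] at hxy; subst hxy; exact absurd hy.symm h.sa
  into_a := by
    intro e xy hxy hy
    have hc := h.core e xy hxy (by simp [hy])
    rcases hc with rfl | rfl | rfl | rfl | rfl
    · rw [h.arc₁] at hxy
      simp only [Finset.mem_insert, Finset.mem_singleton] at hxy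
      rcases hxy with rfl | rfl
      · exact absurd hy h.pa
      · exact absurd hy h.sa
    · rw [h.arc₂] at hxy
      simp only [Finset.mem_insert, Finset.mem_singleton] at hxy
      rcases hxy with rfl | rfl
      · exact absurd hy h.qa
      · exact absurd hy h.sa
    · rw [h.arc₃] at hxy
      simp only [Finset.mem_insert, Finset.mem_singleton] at hxy
      rcases hxy with rfl | rfl
      · exact absurd hy h.qa
      · exact absurd hy h.pa
    · rw [h.arcρ, Finset.mem_singleton] at hxy; subst hxy; exact Or.inl ⟨rfl, rfl⟩
    · rw [h.arcτ, Finset.mem_singleton] at hxy; subst hxy; exact Or.inr ⟨rfl, rfl⟩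
  arcs_ρ := h.arcρ
  arcs_τ := h.arcτ
  ρτ_ne := h.ρτ

/-- The closure lemma: if `Z ⊆ {p, q, a}` and no OPEN coin carries an arc from outside `Z` into
`Z`, nothing reachable from `s` lies in `Z`. -/
lemma TriCore.not_reach_of_closed (h : TriCore arcs s p q a c₁ c₂ c₃ cρ cτ) {ω : Config E}
    {Z : Set V} (hZs : s ∉ Z) (hZ : ∀ v ∈ Z, v = p ∨ v = q ∨ v = a)
    (h₁ : ω c₁ = true → p ∈ Z → s ∈ Z) (h₂ : ω c₂ = true → q ∈ Z → s ∈ Z)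
    (h₃ : ω c₃ = true → q ∈ Z → p ∈ Z) (h₃' : ω c₃ = true → p ∈ Z → q ∈ Z)
    (hρ : ω cρ = true → a ∈ Z → p ∈ Z) (hτ : ω cτ = true → a ∈ Z → q ∈ Z)
    {y : V} (hy : y ∈ Z) : ¬ Reach arcs ω s y := by
  intro hr
  have key := reach_mem_of_closed (U := Zᶜ) ?_ hZs hr
  · exact key hy
  · intro e he xy hxy hx hy'
    have hc := h.core e xy hxy (by rcases hZ _ hy' with h' | h' | h' <;> simp [h'])
    rcases hc with rfl | rfl | rfl | rfl | rfl
    · rw [h.arc₁] at hxy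
      simp only [Finset.mem_insert, Finset.mem_singleton] at hxy
      rcases hxy with rfl | rfl
      · exact hx (h₁ he hy')
      · exact hZs hy'
    · rw [h.arc₂] at hxy
      simp only [Finset.mem_insert, Finset.mem_singleton] at hxy
      rcases hxy with rfl | rfl
      · exact hx (h₂ he hy')
      · exact hZs hy'
    · rw [h.arc₃] at hxy
      simp only [Finset.mem_insert, Finset.mem_singleton] at hxy
      rcases hxy with rfl | rfl
      · exact hx (h₃ he hy')
      · exact hx (h₃' he hy')
    · rw [h.arcρ, Finset.mem_singleton] at hxy; subst hxy; exact hx (hρ he hy')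
    · rw [h.arcτ, Finset.mem_singleton] at hxy; subst hxy; exact hx (hτ he hy')

/-- `s ⇝ p` iff `α` is open or the route `β, γ` is open. -/
theorem TriCore.reach_p_iff (h : TriCore arcs s p q a c₁ c₂ c₃ cρ cτ) (ω : Config E) :
    Reach arcs ω s p ↔ ω c₁ = true ∨ (ω c₂ = true ∧ ω c₃ = true) := by
  constructor
  · intro hr
    by_cases hb1 : ω c₁ = true
    · exact Or.inl hb1
    simp only [Bool.not_eq_true] at hb1
    by_cases h23 : ω c₂ = true ∧ ω c₃ = true
    · exact Or.inr h23
    exfalso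
    by_cases hb2 : ω c₂ = true
    · have hb3 : ω c₃ = false := by
        cases hc : ω c₃
        · rfl
        · exact absurd ⟨hb2, hc⟩ h23
      refine h.not_reach_of_closed (Z := {v | v = p}) (by simp [h.sp]) (by simp) ?_ ?_ ?_ ?_ ?_ ?_
        (by simp) hr
      · intro h'; simp [hb1] at h'
      · intro _ h'; simp [h.pq.symm] at h'
      · intro _ h'; simp [h.pq.symm] at h'
      · intro h'; simp [hb3] at h'
      · intro _ h'; simp [h.pa.symm] at h'
      · intro _ h'; simp [h.pa.symm] at h'
    · simp only [Bool.not_eq_true] at hb2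
      refine h.not_reach_of_closed (Z := {v | v = p ∨ v = q}) (by simp [h.sp, h.sq]) (by simp)
        ?_ ?_ ?_ ?_ ?_ ?_ (by simp) hr
      · intro h'; simp [hb1] at h'
      · intro h'; simp [hb2] at h'
      · intro _ _; simp
      · intro _ _; simp
      · intro _ h'; simp [h.pa.symm, h.qa.symm] at h'
      · intro _ h'; simp [h.pa.symm, h.qa.symm] at h'
  · rintro (h1 | ⟨h2, h3⟩)
    · exact reach_of_openArc ⟨c₁, h1, by rw [h.arc₁]; simp⟩
    · have r1 : Reach arcs ω s q := reach_of_openArc ⟨c₂, h2, by rw [h.arc₂]; simp⟩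
      have r2 : Reach arcs ω q p := reach_of_openArc ⟨c₃, h3, by rw [h.arc₃]; simp⟩
      exact reach_trans r1 r2

/-- `s ⇝ q` iff `β` is open or the route `α, γ` is open. -/
theorem TriCore.reach_q_iff (h : TriCore arcs s p q a c₁ c₂ c₃ cρ cτ) (ω : Config E) :
    Reach arcs ω s q ↔ ω c₂ = true ∨ (ω c₁ = true ∧ ω c₃ = true) := by
  constructor
  · intro hr
    by_cases hb2 : ω c₂ = true
    · exact Or.inl hb2
    simp only [Bool.not_eq_true] at hb2
    by_cases h13 : ω c₁ = true ∧ ω c₃ = true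
    · exact Or.inr h13
    exfalso
    by_cases hb1 : ω c₁ = true
    · have hb3 : ω c₃ = false := by
        cases hc : ω c₃
        · rfl
        · exact absurd ⟨hb1, hc⟩ h13
      refine h.not_reach_of_closed (Z := {v | v = q}) (by simp [h.sq]) (by simp) ?_ ?_ ?_ ?_ ?_ ?_
        (by simp) hr
      · intro _ h'; simp [h.pq] at h'
      · intro h'; simp [hb2] at h'
      · intro h'; simp [hb3] at h'
      · intro _ h'; simp [h.pq] at h'
      · intro _ h'; simp [h.qa.symm] at h'
      · intro _ h'; simp [h.qa.symm] at h'
    · simp only [Bool.not_eq_true] at hb1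
      refine h.not_reach_of_closed (Z := {v | v = p ∨ v = q}) (by simp [h.sp, h.sq]) (by simp)
        ?_ ?_ ?_ ?_ ?_ ?_ (by simp) hr
      · intro h'; simp [hb1] at h'
      · intro h'; simp [hb2] at h'
      · intro _ _; simp
      · intro _ _; simp
      · intro _ h'; simp [h.pa.symm, h.qa.symm] at h'
      · intro _ h'; simp [h.pa.symm, h.qa.symm] at h'
  · rintro (h2 | ⟨h1, h3⟩)
    · exact reach_of_openArc ⟨c₂, h2, by rw [h.arc₂]; simp⟩
    · have r1 : Reach arcs ω s p := reach_of_openArc ⟨c₁, h1, by rw [h.arc₁]; simp⟩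
      have r2 : Reach arcs ω p q := reach_of_openArc ⟨c₃, h3, by rw [h.arc₃]; simp⟩
      exact reach_trans r1 r2

end TriCoreDefs

end Summit.Ventures.PercRepro2.Coin
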